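import Mathlib
import Literature.Combinatorics.Enumerative.BregmanMinc
import Literature.Combinatorics.Enumerative.VanDerWaerdenPermanentProofs

/-!
# `DivisionGap.PerCofactorDegreeReduction` (stmt-ValiantsHypothesis-15046), line `Sketch_ideator4`
(idea intrinsic-member-descent), stub `stub_matchingPadding` — part 2/3: permanent bounds and the
analytic estimates

* `factorial_mul_pow_le_permanent`: for a tuple `ω` the matrix `A x i = #{k : ω k i = x}` (sum of
  the `r` permutation matrices) has all line sums `r`, so van der Waerden (Egorychev–Falikman, tree:
  `VanDerWaerdenPermanent_holds`) gives `n! rⁿ ≤ nⁿ per A`.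
* `permanent_countMatrix_le`: `per A ≤ e^{agreements} · #{σ : every (σ i, i) is a padding cell}` — a
  permutation contributes `∏_i #{k : ω k i = σ i}`, zero unless `σ` is a perfect matching of the
  padding graph, and `#{k : ω k i = x} ≤ 1 + #{(k ≠ l) : ω k i = ω l i}`
  (`card_filter_apply_eq_le`).
* `log_card_le_sum_log_factorial_div_of_subset`: Brégman–Minc (tree) for permutations with
  prescribed value sets; `log_factorial_le` (Stirling's upper bound `m! ≤ e √m (m/e)^m`),
  `log_factorial_div_le_affine` (`log (m!)/m ≤ log K - 2 + m/K + 4 log K/K`, `K ≥ 8`, `m ≥ 1`)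
  and its summed form `sum_log_factorial_div_le`.
* `split_geometry` (`n² - 2sn + 2s² ≤ (5/9) n²` on `n ≤ 3s ≤ 2n`) and `numeric_bound`
  (`log K - 1 + 4 log K/K + (log 2)/10 ≤ log r - 1 - 2/25` for `K = 19r/25`, `r ≥ 400`).
* `card_filter_iff_add`, `sum_card_filter_iff`: the cells of a permutation inside the two blocks
  `S × T ⊔ Sᶜ × Tᶜ` of a split with `|S| = |T| = s` number `n - 2s + 2 #{j ∈ T : π j ∈ S}`.
-/

-- `Summit.ValiantsHypothesis.ValiantsHypothesis.…` is the tree's mandated single-conjunct layout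
-- (Sub = Summit), so the duplicated namespace component is intended.
set_option linter.dupNamespace false

open scoped NNReal BigOperators
open Finset

namespace Summit.ValiantsHypothesis.ValiantsHypothesis.Theorems.DivisionGap.PerCofactorDegreeReduction.MatchingPadding

variable {n r : ℕ}

/-! ### The van der Waerden lower bound for the padding graph -/

/-- Every row of `countMatrix ω` sums to `r`. [folklore] -/
theorem countMatrix_row_sum (ω : Fin r → Equiv.Perm (Fin n)) (x : Fin n) :
    ∑ i, ((((Finset.univ : Finset (Fin r)).filter fun k => ω k i = x).card : ℕ) : ℝ) = r := by
  have h : ∑ i : Fin n, ((Finset.univ : Finset (Fin r)).filter fun k => ω k i = x).card = r := by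
    calc ∑ i : Fin n, ((Finset.univ : Finset (Fin r)).filter fun k => ω k i = x).card
        = ∑ i : Fin n, ∑ k : Fin r, (if ω k i = x then 1 else 0) := by
          simp only [Finset.card_filter]
      _ = ∑ k : Fin r, ∑ i : Fin n, (if ω k i = x then 1 else 0) := Finset.sum_comm
      _ = ∑ k : Fin r, 1 := by
          refine Finset.sum_congr rfl fun k _ => ?_
          have : ∀ i : Fin n, (ω k i = x) ↔ (i = (ω k).symm x) := fun i => by
            rw [Equiv.eq_symm_apply]
          simp_rw [this]
          rw [Finset.sum_ite_eq']
          simp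
      _ = r := by simp
  exact_mod_cast h

/-- Every column of `countMatrix ω` sums to `r`. [folklore] -/
theorem countMatrix_col_sum (ω : Fin r → Equiv.Perm (Fin n)) (i : Fin n) :
    ∑ x, ((((Finset.univ : Finset (Fin r)).filter fun k => ω k i = x).card : ℕ) : ℝ) = r := by
  have h : ∑ x : Fin n, ((Finset.univ : Finset (Fin r)).filter fun k => ω k i = x).card = r := by
    calc ∑ x : Fin n, ((Finset.univ : Finset (Fin r)).filter fun k => ω k i = x).card
        = ∑ x : Fin n, ∑ k : Fin r, (if ω k i = x then 1 else 0) := by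
          simp only [Finset.card_filter]
      _ = ∑ k : Fin r, ∑ x : Fin n, (if ω k i = x then 1 else 0) := Finset.sum_comm
      _ = ∑ k : Fin r, 1 := by
          refine Finset.sum_congr rfl fun k _ => ?_
          rw [Finset.sum_ite_eq]
          simp
      _ = r := by simp
  exact_mod_cast h

/-- **Van der Waerden for the padding**: `n! · rⁿ ≤ nⁿ · per (countMatrix ω)` (`r ≥ 1`), since
`countMatrix ω / r` is doubly stochastic. [cite: Egorychev1981, Theorem 1 (p. 300)] -/
theorem factorial_mul_pow_le_permanent (hr : 0 < r) (ω : Fin r → Equiv.Perm (Fin n)) :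
    (n.factorial : ℝ) * (r : ℝ) ^ n ≤ (n : ℝ) ^ n * (Matrix.of fun x i =>
      (((Finset.univ.filter fun k : Fin r => ω k i = x).card : ℕ) : ℝ)).permanent := by
  set A : Matrix (Fin n) (Fin n) ℝ := Matrix.of fun x i =>
    (((Finset.univ.filter fun k : Fin r => ω k i = x).card : ℕ) : ℝ) with hA
  have hr' : (0 : ℝ) < r := by exact_mod_cast hr
  have h := Literature.Combinatorics.Enumerative.VanDerWaerdenPermanent_holds n
    ((r : ℝ)⁻¹ • A) ?_ ?_ ?_
  · rw [Matrix.permanent_smul, Fintype.card_fin] at h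
    have hrn : (r : ℝ) ^ n ≠ 0 := pow_ne_zero _ hr'.ne'
    calc (n.factorial : ℝ) * (r : ℝ) ^ n
        ≤ (n : ℝ) ^ n * ((r : ℝ)⁻¹ ^ n * A.permanent) * (r : ℝ) ^ n := by
          gcongr
      _ = (n : ℝ) ^ n * A.permanent * (((r : ℝ) ^ n)⁻¹ * (r : ℝ) ^ n) := by
          rw [inv_pow]; ring
      _ = (n : ℝ) ^ n * A.permanent := by
          rw [inv_mul_cancel₀ hrn, mul_one]
  · intro i j
    simp only [hA, Matrix.smul_apply, smul_eq_mul, Matrix.of_apply]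
    positivity
  · intro i
    simp only [hA, Matrix.smul_apply, smul_eq_mul, Matrix.of_apply, ← Finset.mul_sum,
      countMatrix_row_sum]
    field_simp
  · intro j
    simp only [hA, Matrix.smul_apply, smul_eq_mul, Matrix.of_apply, ← Finset.mul_sum,
      countMatrix_col_sum]
    field_simp

/-- Multiplicities are controlled by agreements: `#{k : ω k i = x} ≤ 1 + #{(k,l) : k ≠ l,
ω k i = ω l i}`. [folklore] -/
theorem card_filter_apply_eq_le (ω : Fin r → Equiv.Perm (Fin n)) (i x : Fin n) :
    ((Finset.univ : Finset (Fin r)).filter fun k => ω k i = x).card ≤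
      1 + (Finset.univ.filter fun p : Fin r × Fin r => p.1 ≠ p.2 ∧ ω p.1 i = ω p.2 i).card := by
  set F := (Finset.univ : Finset (Fin r)).filter fun k => ω k i = x with hF
  rcases F.eq_empty_or_nonempty with hF0 | ⟨k₀, hk₀⟩
  · rw [hF0]; simp
  · have hk₀' : ω k₀ i = x := (Finset.mem_filter.mp hk₀).2
    have h : (F.erase k₀).card ≤ (Finset.univ.filter
      fun p : Fin r × Fin r => p.1 ≠ p.2 ∧ ω p.1 i = ω p.2 i).card := by
      apply Finset.card_le_card_of_injOn (fun l => (k₀, l))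
      · intro l hl
        rw [Finset.mem_coe, Finset.mem_erase] at hl
        have hl' : ω l i = x := (Finset.mem_filter.mp hl.2).2
        rw [Finset.mem_coe, Finset.mem_filter]
        refine ⟨Finset.mem_univ _, ?_, ?_⟩
        · show k₀ ≠ l
          exact fun h => hl.1 h.symm
        · show ω k₀ i = ω l i
          rw [hk₀', hl']
      · intro l _ l' _ h
        exact (Prod.mk.inj h).2
    rw [Finset.card_erase_of_mem hk₀] at h
    have hpos : 0 < F.card := Finset.card_pos.mpr ⟨k₀, hk₀⟩
    omega

/-- **Permanent versus matchings of the padding graph**: `per (countMatrix ω) ≤ e^{agr ω} ·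
#{σ : every (σ i, i) is a padding edge}` — a permutation contributes `∏_i #{k : ω k i = σ i}`,
which vanishes unless it is a perfect matching of the padding graph and is at most
`∏_i (1 + agreements in column i) ≤ e^{agr ω}` otherwise. [folklore] -/
theorem permanent_countMatrix_le (ω : Fin r → Equiv.Perm (Fin n)) :
    (Matrix.of fun x i =>
        (((Finset.univ.filter fun k : Fin r => ω k i = x).card : ℕ) : ℝ)).permanent ≤
      Real.exp (∑ i, (((Finset.univ.filter
          fun p : Fin r × Fin r => p.1 ≠ p.2 ∧ ω p.1 i = ω p.2 i).card : ℕ) : ℝ)) *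
        ((Finset.univ : Finset (Equiv.Perm (Fin n))).filter
          fun σ => ∀ i, ∃ k, ω k i = σ i).card := by
  unfold Matrix.permanent
  simp only [Matrix.of_apply]
  rw [Finset.card_filter, Nat.cast_sum, Finset.mul_sum]
  refine Finset.sum_le_sum fun σ _ => ?_
  split_ifs with hσ
  · simp only [Nat.cast_one, mul_one]
    calc ∏ i, ((((Finset.univ : Finset (Fin r)).filter fun k => ω k i = σ i).card : ℕ) : ℝ)
        ≤ ∏ i, (1 + ((Finset.univ.filter
          fun p : Fin r × Fin r => p.1 ≠ p.2 ∧ ω p.1 i = ω p.2 i).card : ℝ)) := by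
          refine Finset.prod_le_prod (fun i _ => by positivity) fun i _ => ?_
          exact_mod_cast card_filter_apply_eq_le ω i (σ i)
      _ ≤ ∏ i, Real.exp ((Finset.univ.filter
        fun p : Fin r × Fin r => p.1 ≠ p.2 ∧ ω p.1 i = ω p.2 i).card : ℝ) := by
          refine Finset.prod_le_prod (fun i _ => by positivity) fun i _ => ?_
          linarith [Real.add_one_le_exp (((Finset.univ.filter
            fun p : Fin r × Fin r => p.1 ≠ p.2 ∧ ω p.1 i = ω p.2 i).card : ℝ))]
      _ = Real.exp (∑ i, (((Finset.univ.filter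
        fun p : Fin r × Fin r => p.1 ≠ p.2 ∧ ω p.1 i = ω p.2 i).card : ℕ) : ℝ)) := by
          rw [← Real.exp_sum]
  · simp only [Nat.cast_zero, mul_zero]
    push Not at hσ
    obtain ⟨i, hi⟩ := hσ
    apply le_of_eq
    apply Finset.prod_eq_zero (Finset.mem_univ i)
    simp only [Nat.cast_eq_zero, Finset.card_eq_zero]
    exact Finset.filter_eq_empty_iff.mpr fun k _ => hi k

/-! ### Brégman–Minc for block matchings and the factorial exponent -/

/-- **Brégman–Minc with prescribed column supports.**  If every `σ ∈ X` satisfies `σ j ∈ B j`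
for all `j`, then `log #X ≤ ∑_j log (|B j|!) / |B j|` (`X ≠ ∅`): the row supports of `X` lie
inside the `B j` and `m ↦ log (m!) / m` is monotone. [cite: Bregman1973, Thm 1] -/
theorem log_card_le_sum_log_factorial_div_of_subset (X : Finset (Equiv.Perm (Fin n)))
    (hX : X.Nonempty) (B : Fin n → Finset (Fin n)) (hB : ∀ σ ∈ X, ∀ j, σ j ∈ B j) :
    Real.log (X.card : ℝ) ≤ ∑ j, Real.log (((B j).card.factorial : ℕ) : ℝ) / ((B j).card : ℝ) := by
  refine (Literature.Combinatorics.Enumerative.log_card_le_sum_log_factorial_div X hX).trans ?_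
  refine Finset.sum_le_sum fun j _ => ?_
  have hsub : X.image (fun σ => σ j) ⊆ B j := by
    intro x hx
    obtain ⟨σ, hσ, rfl⟩ := Finset.mem_image.mp hx
    exact hB σ hσ j
  exact Literature.Combinatorics.Enumerative.log_factorial_div_mono (Finset.card_le_card hsub)

/-- **Stirling's upper bound** `m! ≤ e √m (m/e)^m` in logarithmic form:
`log (m!) ≤ m log m - m + 1 + (log m)/2` for `m ≥ 1` (the Stirling sequence is decreasing).
[folklore] -/
theorem log_factorial_le (m : ℕ) (hm : 1 ≤ m) :
    Real.log (m.factorial : ℝ) ≤ m * Real.log m - m + 1 + Real.log m / 2 := by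
  obtain ⟨k, rfl⟩ : ∃ k, m = k + 1 := ⟨m - 1, by omega⟩
  have h1 : Stirling.stirlingSeq (k + 1) ≤ Stirling.stirlingSeq (0 + 1) :=
    Stirling.stirlingSeq'_antitone (Nat.zero_le k)
  rw [zero_add, Stirling.stirlingSeq_one] at h1
  unfold Stirling.stirlingSeq at h1
  set M : ℝ := ((k + 1 : ℕ) : ℝ) with hM
  have hM0 : 0 < M := by rw [hM]; positivity
  have hden : 0 < Real.sqrt (2 * M) * (M / Real.exp 1) ^ (k + 1) := by positivity
  rw [div_le_iff₀ hden] at h1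
  have hlog := Real.log_le_log (by positivity) h1
  have hsqrt : Real.sqrt (2 * M) = Real.sqrt 2 * Real.sqrt M := Real.sqrt_mul (by norm_num) M
  have hsM : 0 < Real.sqrt M := Real.sqrt_pos.mpr hM0
  have hrhs : Real.exp 1 / Real.sqrt 2 * (Real.sqrt (2 * M) * (M / Real.exp 1) ^ (k + 1)) =
      Real.exp 1 * Real.sqrt M * (M / Real.exp 1) ^ (k + 1) := by
    rw [hsqrt]; field_simp
  rw [hrhs, Real.log_mul (by positivity) (by positivity), Real.log_mul (by positivity) hsM.ne',
    Real.log_exp, Real.log_pow, Real.log_div hM0.ne' (Real.exp_pos 1).ne', Real.log_exp,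
    Real.log_sqrt hM0.le] at hlog
  have hcast : ((k + 1 : ℕ) : ℝ) = M := rfl
  rw [hcast] at hlog
  linarith

/-- **Affine majorant of the Brégman exponent.**  For `K ≥ 8` and every `m ≥ 1`,
`log (m!) / m ≤ log K - 2 + m/K + 4 log K / K` (tangent line of the concave function
`log m - 1` at `K`, plus Stirling's correction `(1 + log m / 2)/m ≤ 4 log K / K` for `m ≥ K/8`;
for `m < K/8` the slack `log 8 ≥ 2` of the tangent absorbs the correction). [folklore] -/
theorem log_factorial_div_le_affine {K : ℝ} (hK : 8 ≤ K) (m : ℕ) (hm : 1 ≤ m) :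
    Real.log (m.factorial : ℝ) / m ≤ Real.log K - 2 + m / K + 4 * Real.log K / K := by
  have hm' : (1 : ℝ) ≤ m := by exact_mod_cast hm
  have hm0 : (0 : ℝ) < m := by linarith
  have hK0 : 0 < K := by linarith
  have hlog8 : 2 ≤ Real.log 8 := by
    have : Real.log 8 = 3 * Real.log 2 := by
      rw [show (8 : ℝ) = 2 ^ 3 by norm_num, Real.log_pow]; norm_num
    rw [this]; linarith [Real.log_two_gt_d9]
  have hlogK : 2 ≤ Real.log K := hlog8.trans (Real.log_le_log (by norm_num) hK)
  have hdiv : Real.log (m.factorial : ℝ) / m ≤ Real.log m - 1 + (1 + Real.log m / 2) / m := by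
    rw [div_le_iff₀ hm0]
    have : (Real.log m - 1 + (1 + Real.log m / 2) / m) * m =
        m * Real.log m - m + 1 + Real.log m / 2 := by
      field_simp
      ring
    rw [this]
    exact log_factorial_le m hm
  by_cases hcase : K / 8 ≤ m
  · have ht : Real.log m ≤ Real.log K - 1 + m / K := by
      have := Real.log_le_sub_one_of_pos (show 0 < (m : ℝ) / K by positivity)
      rw [Real.log_div hm0.ne' hK0.ne'] at this
      linarith
    have hy : 1 ≤ K / 8 := by linarith
    have hly : 0 ≤ Real.log (K / 8) := Real.log_nonneg hy
    have hu : (1 + Real.log m / 2) / m ≤ (1 + Real.log (K / 8) / 2) / (K / 8) := by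
      have hlm : Real.log m ≤ Real.log (K / 8) + m / (K / 8) - 1 := by
        have := Real.log_le_sub_one_of_pos (show 0 < (m : ℝ) / (K / 8) by positivity)
        rw [Real.log_div hm0.ne' (by positivity)] at this
        linarith
      rw [div_le_div_iff₀ hm0 (by positivity)]
      have e1 : (K / 8) * Real.log m ≤ (K / 8) * (Real.log (K / 8) + m / (K / 8) - 1) :=
        mul_le_mul_of_nonneg_left hlm (by positivity)
      have e2 : (K / 8) * (m / (K / 8)) = m := by field_simp
      nlinarith [e1, e2, hcase, hly, mul_le_mul_of_nonneg_right hcase hly]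
    have hu2 : (1 + Real.log (K / 8) / 2) / (K / 8) ≤ 4 * Real.log K / K := by
      rw [Real.log_div hK0.ne' (by norm_num), div_le_div_iff₀ (by positivity) hK0]
      nlinarith [hlog8, hK0, hlogK]
    calc Real.log (m.factorial : ℝ) / m ≤ Real.log m - 1 + (1 + Real.log m / 2) / m := hdiv
      _ ≤ (Real.log K - 1 + m / K) - 1 + 4 * Real.log K / K := by linarith [ht, hu, hu2]
      _ = Real.log K - 2 + m / K + 4 * Real.log K / K := by ring
  · push Not at hcase
    have h1 : Real.log m ≤ Real.log K - 2 := by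
      have := Real.log_lt_log hm0 hcase
      rw [Real.log_div hK0.ne' (by norm_num)] at this
      linarith
    have h2 : (1 + Real.log m / 2) / m ≤ 1 := by
      rw [div_le_one hm0]
      have := Real.log_le_sub_one_of_pos hm0
      linarith
    have h3 : 0 ≤ (m : ℝ) / K := by positivity
    have h4 : 0 ≤ 4 * Real.log K / K := div_nonneg (by linarith) hK0.le
    linarith [hdiv, h1, h2, h3, h4]

/-- Summed form: if `1 ≤ b j` for all `j` and `∑_j b j ≤ n K` (`K ≥ 8`) then
`∑_j log ((b j)!) / b j ≤ n (log K - 1 + 4 log K / K)`. [folklore] -/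
theorem sum_log_factorial_div_le {n : ℕ} {K : ℝ} (hK : 8 ≤ K) (b : Fin n → ℕ) (hb : ∀ j, 1 ≤ b j)
    (hsum : (∑ j, (b j : ℝ)) ≤ n * K) :
    ∑ j, Real.log (((b j).factorial : ℕ) : ℝ) / ((b j : ℕ) : ℝ) ≤
      n * (Real.log K - 1 + 4 * Real.log K / K) := by
  have hK0 : 0 < K := by linarith
  calc ∑ j, Real.log (((b j).factorial : ℕ) : ℝ) / ((b j : ℕ) : ℝ)
      ≤ ∑ j : Fin n, (Real.log K - 2 + (b j : ℝ) / K + 4 * Real.log K / K) :=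
        Finset.sum_le_sum fun j _ => log_factorial_div_le_affine hK (b j) (hb j)
    _ = n * (Real.log K - 2 + 4 * Real.log K / K) + (∑ j, (b j : ℝ)) / K := by
        simp only [Finset.sum_add_distrib, Finset.sum_const, Finset.card_univ, Fintype.card_fin,
          nsmul_eq_mul, Finset.sum_div]
        ring
    _ ≤ n * (Real.log K - 2 + 4 * Real.log K / K) + (n * K) / K := by gcongr
    _ = n * (Real.log K - 1 + 4 * Real.log K / K) := by
        field_simp
        ring


/-! ### Two real-variable estimates -/

/-- The geometry of balanced splits: for `n < 3s ≤ 2n`, `n² - 2 s n + 2 s² ≤ (5/9) n²`, in the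
form `r n - 2 r s + 2 r (s²/n + n/10) ≤ r n (5/9 + 1/5)`. [folklore] -/
theorem split_geometry {r s n : ℝ} (hr : 0 ≤ r) (hn : 0 < n) (h1 : n ≤ 3 * s) (h2 : 3 * s ≤ 2 * n) :
    r * n - 2 * r * s + 2 * (r * (s ^ 2 / n + n / 10)) ≤ r * n * (5 / 9 + 1 / 5) := by
  have key : n - 2 * s + 2 * (s ^ 2 / n + n / 10) ≤ n * (5 / 9 + 1 / 5) := by
    have hprod : (3 * s - n) * (3 * s - 2 * n) ≤ 0 :=
      mul_nonpos_of_nonneg_of_nonpos (by linarith) (by linarith)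
    have hs2 : s ^ 2 / n = s ^ 2 * n⁻¹ := div_eq_mul_inv _ _
    have hn1 : n * n⁻¹ = 1 := mul_inv_cancel₀ hn.ne'
    have hinv : 0 < n⁻¹ := inv_pos.mpr hn
    have := mul_le_mul_of_nonneg_left hprod hinv.le
    nlinarith [this, hn1, hs2, hinv]
  have := mul_le_mul_of_nonneg_left key hr
  linarith [this]

/-- The numerical heart: with `K = 19 r / 25` and `r ≥ 400`,
`log K - 1 + 4 log K / K + (log 2)/10 ≤ log r - 1 - 2/25`. [folklore] -/
theorem numeric_bound {r : ℝ} (hr : 400 ≤ r) :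
    Real.log (19 * r / 25) - 1 + 4 * Real.log (19 * r / 25) / (19 * r / 25) + Real.log 2 / 10 ≤
      Real.log r - 1 - 2 / 25 := by
  set K := 19 * r / 25 with hK
  have hK304 : 304 ≤ K := by rw [hK]; linarith
  have hK0 : 0 < K := by linarith
  have h1 : Real.log K ≤ Real.log r - 6 / 25 := by
    rw [hK, show 19 * r / 25 = r * (19 / 25) by ring, Real.log_mul (by linarith) (by norm_num)]
    have := Real.log_le_sub_one_of_pos (show (0 : ℝ) < 19 / 25 by norm_num)
    linarith
  have h2 : 4 * Real.log K / K ≤ 0.0822 := by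
    have hl304 : Real.log 304 ≤ 6.2384 := by
      have : Real.log 304 ≤ Real.log 512 := Real.log_le_log (by norm_num) (by norm_num)
      have h512 : Real.log 512 = 9 * Real.log 2 := by
        rw [show (512 : ℝ) = 2 ^ 9 by norm_num, Real.log_pow]; norm_num
      linarith [Real.log_two_lt_d9]
    have hlK : Real.log K ≤ Real.log 304 + K / 304 - 1 := by
      have := Real.log_le_sub_one_of_pos (show 0 < K / 304 by positivity)
      rw [Real.log_div hK0.ne' (by norm_num)] at this
      linarith
    rw [div_le_iff₀ hK0]
    linarith [hlK, hl304, hK304]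
  have h3 : Real.log 2 / 10 ≤ 0.06931471808 := by linarith [Real.log_two_lt_d9]
  linarith [h1, h2, h3]


/-! ### Block cells of a permutation -/

/-- For a permutation `π` and `|T| = |S|`:
`#{j : (π j ∈ S ↔ j ∈ T)} + 2|S| = n + 2 #{j ∈ T : π j ∈ S}` (the cells of `π` inside the two
blocks `S × T`, `Sᶜ × Tᶜ`). [folklore] -/
theorem card_filter_iff_add (π : Equiv.Perm (Fin n)) (S T : Finset (Fin n))
    (hST : T.card = S.card) :
    ((Finset.univ : Finset (Fin n)).filter fun j => (π j ∈ S ↔ j ∈ T)).card + 2 * S.card =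
      n + 2 * (T.filter fun j => π j ∈ S).card := by
  have key : ∀ j : Fin n, (if (π j ∈ S ↔ j ∈ T) then 1 else 0) + (if j ∈ T then 1 else 0) +
      (if π j ∈ S then 1 else 0) = 1 + 2 * (if (j ∈ T ∧ π j ∈ S) then 1 else 0) := by
    intro j
    by_cases h1 : π j ∈ S <;> by_cases h2 : j ∈ T <;> simp [h1, h2]
  have h := Finset.sum_congr rfl fun j (_ : j ∈ (Finset.univ : Finset (Fin n))) => key j
  rw [Finset.sum_add_distrib, Finset.sum_add_distrib, Finset.sum_add_distrib, ← Finset.mul_sum,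
    ← Finset.card_filter, ← Finset.card_filter, ← Finset.card_filter, ← Finset.card_filter,
    Finset.sum_const, Finset.card_univ, Fintype.card_fin, smul_eq_mul, mul_one,
    Finset.filter_univ_mem, Literature.Combinatorics.Enumerative.card_filter_apply_mem, hST] at h
  have hTS : ((Finset.univ : Finset (Fin n)).filter fun j => j ∈ T ∧ π j ∈ S) =
      T.filter fun j => π j ∈ S := by
    ext j; simp
  rw [hTS] at h
  omega

/-- Summing the block cells of all permutations of the tuple over the columns:
`∑_j #{k : (ω k j ∈ S ↔ j ∈ T)} = r n - 2 r |S| + 2 ∑_k hits (ω k)`. [folklore] -/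
theorem sum_card_filter_iff (ω : Fin r → Equiv.Perm (Fin n)) (S T : Finset (Fin n))
    (hST : T.card = S.card) :
    (∑ j : Fin n, ((((Finset.univ : Finset (Fin r)).filter
        fun k => (ω k j ∈ S ↔ j ∈ T)).card : ℕ) : ℝ)) =
      (r : ℝ) * n - 2 * r * S.card + 2 * ∑ k, ((T.filter fun j => ω k j ∈ S).card : ℝ) := by
  have h1 : ∑ j : Fin n, ((Finset.univ : Finset (Fin r)).filter
        fun k => (ω k j ∈ S ↔ j ∈ T)).card =
      ∑ k : Fin r, ((Finset.univ : Finset (Fin n)).filter fun j => (ω k j ∈ S ↔ j ∈ T)).card := by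
    simp only [Finset.card_filter]
    exact Finset.sum_comm
  have h1' : (∑ j : Fin n, ((((Finset.univ : Finset (Fin r)).filter
        fun k => (ω k j ∈ S ↔ j ∈ T)).card : ℕ) : ℝ)) =
      ∑ k : Fin r, ((((Finset.univ : Finset (Fin n)).filter
        fun j => (ω k j ∈ S ↔ j ∈ T)).card : ℕ) : ℝ) := by
    exact_mod_cast h1
  have h2 : ∀ k : Fin r, ((((Finset.univ : Finset (Fin n)).filter
      fun j => (ω k j ∈ S ↔ j ∈ T)).card : ℕ) : ℝ) =
        n + 2 * ((T.filter fun j => ω k j ∈ S).card : ℝ) - 2 * S.card := by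
    intro k
    have h := card_filter_iff_add (ω k) S T hST
    have h' : ((((Finset.univ : Finset (Fin n)).filter
        fun j => (ω k j ∈ S ↔ j ∈ T)).card : ℕ) : ℝ) + 2 * (S.card : ℝ) =
        (n : ℝ) + 2 * ((T.filter fun j => ω k j ∈ S).card : ℝ) := by
      exact_mod_cast h
    linarith
  rw [h1', Finset.sum_congr rfl fun k _ => h2 k]
  simp only [Finset.sum_sub_distrib, Finset.sum_add_distrib, Finset.sum_const, Finset.card_univ,
    Fintype.card_fin, nsmul_eq_mul, ← Finset.mul_sum]
  ring

end Summit.ValiantsHypothesis.ValiantsHypothesis.Theorems.DivisionGap.PerCofactorDegreeReduction.MatchingPadding
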